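import Summits.ValiantsHypothesis.ValiantsHypothesis.Theorems.BarrierLeverDefinableEquationsIsobaric
import Summits.ValiantsHypothesis.ValiantsHypothesis.Theorems.BarrierLeverDefinableEquationsTopEquations

/-!
# Crux `BarrierLever.DefinableEquations` (stmt-ValiantsHypothesis-8745) / `SingleSizeEquations`
# (8749) — NORMAL FORM, GCT-ready: the witness may be taken to be a WEIGHT VECTOR of
# `Sym^d(Sym^n ℂ^n)^*` (top-supported, homogeneous of degree `d`, isobaric of weight `w` for the
# torus `(ℂ^×)^n`, `Σ_i w_i = n·d`)

This file combines the two normal forms of the crux in the tree: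

* TOP SUPPORT (`TopEquations.definableEquations_iff`, lead c6): the witness `E = boolSum H` may be
  taken to involve only the coefficient variables `c_m` with `|m| = n` (coordinates of `Sym^n ℂ^n`);
* TORUS WEIGHT VECTOR (`IsobaricEquations.definableEquations_iff_isobaric`, this seat): the witness
  may be taken homogeneous of some degree `d` and isobaric of some weight `w_i` for every
  coordinate grading `c_m ↦ m_i`;

into ONE (`definableEquations_iff_weightVector`): `DefinableEquations` holds iff for ONE level `a`
and EVERY `b`, eventually in `n`, some nonzero level-`a` Boolean sum `E` vanishing at `coeff f` for
all `f ∈ SmallCircuits ℂ n b` is supported on the top coefficients AND is a torus weight vector of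
weight `(d; w_0, …, w_{n-1})` with `Σ_i w_i = n·d` — i.e. `E` is a weight vector of the
`GL_n`-module `Sym^d(Sym^n ℂ^n)^*`, the space in which the route's plethysm / highest-weight-vector
programme (Kadish–Landsberg shapes, Young-tableau coordinates) is phrased.  The same for the
`∀ b ∃ a` support item (`singleSizeEquations_iff_weightVector`).

Mechanism: the isobaric extraction (`exists_boolSum_eq_weightedHomogeneousComponent`) returns an
isobaric COMPONENT of the given equation, whose support is contained in the original support
(`isoEq_of_eq_support`, the support-tracking form of `isoEq_of_eq`); so a top-supported witness
(from `TopEquations.topEq_succ_of_eq`, renamed into the full frame along `topIncl`) stays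
top-supported, and for a top-supported weight vector `Σ_i w_i = Σ_m α_m |m| = n d`
(`weightSum_eq_of_top`).  Levels: `a ↦ a + 3`; rungs: `b + 6 ↦ b` (`4` for dehomogenisation,
`2` for torus stability).  Pure bookkeeping; no definitions, no named facts.  HONEST FRAMING: a
normal form; the open content of the crux (Chatterjee–Tengse 2023 §1.3 dir. 2) is untouched.
References: [ForbesShpilkaVolk2018] Def. 1; [LandsbergGCT2017] §8; [KadishLandsberg2014].
-/

-- layout Summits/ValiantsHypothesis/ValiantsHypothesis forces the duplicated namespace component
set_option linter.dupNamespace false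

noncomputable section

open MvPolynomial

namespace Summit.ValiantsHypothesis.ValiantsHypothesis.Theorems.BarrierLever.IsobaricEquations

open Literature.Computability.AlgebraicComplexity Literature.Barriers.ValiantsHypothesis
open Summit.ValiantsHypothesis.ValiantsHypothesis.Theorems.BarrierLever.SuccinctHittingSetsForVP
open Summit.ValiantsHypothesis.ValiantsHypothesis.Theorems.BarrierLever.BoolSumComponents
open Summit.ValiantsHypothesis.ValiantsHypothesis.Theorems.BarrierLeverDefinableEquations

variable {n : ℕ}

/-! ## §1 The isobaric extraction keeps the support -/

/-- **`Eq(n, b+2, a) → IsoEq(n, b, a+3)` with support tracking** (`n ≥ 64`, `n ≥ 2a + 6`): the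
isobaric witness produced by `isoEq_of_eq` is an isobaric COMPONENT of the given Boolean sum, so its
support is contained in the given support. [folklore] -/
theorem isoEq_of_eq_support {a b : ℕ} (hn : 64 ≤ n) (ha : 2 * a + 6 ≤ n) {q : ℕ}
    (hq : q ≤ (Nat.choose (2 * n) n) ^ a) (H : MvPolynomial (↥(degLEMonomials n) ⊕ Fin q) ℂ)
    (hc : complexity H ≤ (Nat.choose (2 * n) n) ^ a) (hd : H.totalDegree ≤ (Nat.choose (2 * n) n) ^ a)
    (hne : boolSum H ≠ 0)
    (hvan : ∀ f ∈ SmallCircuits ℂ n (b + 2), eval (coeffVector (degLEMonomials n) f) (boolSum H) = 0) :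
    ∃ q' : ℕ, q' ≤ (Nat.choose (2 * n) n) ^ (a + 3) ∧
      ∃ H' : MvPolynomial (↥(degLEMonomials n) ⊕ Fin q') ℂ,
        complexity H' ≤ (Nat.choose (2 * n) n) ^ (a + 3) ∧
        H'.totalDegree ≤ (Nat.choose (2 * n) n) ^ (a + 3) ∧ boolSum H' ≠ 0 ∧
        (∀ f ∈ SmallCircuits ℂ n b, eval (coeffVector (degLEMonomials n) f) (boolSum H') = 0) ∧
        (boolSum H').support ⊆ (boolSum H).support ∧
        ∃ (d : ℕ) (w : Fin n → ℕ), (boolSum H').IsHomogeneous d ∧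
          ∀ i : Fin n, IsWeightedHomogeneous
            (fun m : degLEMonomials n => (m : Fin n →₀ ℕ) i) (boolSum H') (w i) := by
  classical
  haveI : Fintype (degLEMonomials n) := (Finsupp.finite_of_degree_le (σ := Fin n) n).fintype
  obtain ⟨h5, hnN, -, -⟩ := N_arith hn
  set N := (2 * n).choose n with hNdef
  set E := boolSum H with hEdef
  set B := n * N ^ a + 1 with hBdef
  set W : degLEMonomials n → ℕ := fun m => B ^ n + ∑ i : Fin n, B ^ (i : ℕ) * (m : Fin n →₀ ℕ) i
    with hWdef
  have hB : 0 < B := Nat.succ_pos _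
  have hdegE : E.totalDegree ≤ N ^ a := (totalDegree_boolSum_le H).trans hd
  have hWmax : ∀ m : degLEMonomials n, W m ≤ (n + 1) * B ^ n := by
    intro m
    have hB1 : 1 ≤ B := hB
    have hsum : ∑ i : Fin n, B ^ (i : ℕ) * (m : Fin n →₀ ℕ) i ≤ B ^ n * n := by
      calc ∑ i : Fin n, B ^ (i : ℕ) * (m : Fin n →₀ ℕ) i
          ≤ ∑ i : Fin n, B ^ n * (m : Fin n →₀ ℕ) i := Finset.sum_le_sum fun i _ =>
            Nat.mul_le_mul_right _ (Nat.pow_le_pow_right hB1 i.2.le)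
        _ = B ^ n * ∑ i : Fin n, (m : Fin n →₀ ℕ) i := by rw [Finset.mul_sum]
        _ ≤ B ^ n * n := Nat.mul_le_mul_left _ ?_
      calc ∑ i : Fin n, (m : Fin n →₀ ℕ) i = (m : Fin n →₀ ℕ).degree := by
            rw [Finsupp.degree_apply]
            exact (Finset.sum_subset (Finset.subset_univ _) fun i _ hi =>
              Finsupp.notMem_support_iff.mp hi).symm
        _ ≤ n := m.2
    calc W m = B ^ n + ∑ i : Fin n, B ^ (i : ℕ) * (m : Fin n →₀ ℕ) i := rfl
      _ ≤ B ^ n + B ^ n * n := Nat.add_le_add_left hsum _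
      _ = (n + 1) * B ^ n := by ring
  have hK : weightedTotalDegree W E < 2 ^ N := by
    calc weightedTotalDegree W E ≤ E.totalDegree * ((n + 1) * B ^ n) :=
          weightedTotalDegree_le W _ hWmax E
      _ ≤ N ^ a * ((n + 1) * B ^ n) := Nat.mul_le_mul_right _ hdegE
      _ < 2 ^ N := wdeg_arith hn ha
  obtain ⟨J, hJmem, hJne⟩ : ∃ J ∈ Finset.range (weightedTotalDegree W E + 1),
      weightedHomogeneousComponent W J E ≠ 0 := by
    by_contra hall
    push Not at hall
    apply hne
    rw [hEdef, ← Isobaric.sum_weightedHomogeneousComponent_range W (boolSum H)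
      (weightedTotalDegree W E) (fun d hd => le_weightedTotalDegree W hd)]
    exact Finset.sum_eq_zero hall
  have hJ : J < 2 ^ N := lt_of_le_of_lt (Nat.lt_succ_iff.mp (Finset.mem_range.mp hJmem)) hK
  obtain ⟨H', hsum', hc', hd'⟩ :=
    exists_boolSum_eq_weightedHomogeneousComponent W H (L := N) (J := J) hK hJ
  obtain ⟨lq, lc, ld⟩ := level_arith (a := a) (q := q) (c := complexity H) (d := H.totalDegree)
    h5 hq hc hd
  have hsupp : (weightedHomogeneousComponent W J E).support ⊆ E.support := by
    intro α hα
    rw [mem_support_iff, coeff_weightedHomogeneousComponent] at hα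
    rw [mem_support_iff]
    intro h0; exact hα (by rw [h0, ite_self])
  refine ⟨q + N, lq, H', ?_, hd'.trans ld, ?_, ?_, ?_, ?_⟩
  · refine hc'.trans ?_
    rw [card_degLEMonomials]
    exact lc
  · rw [hsum']; exact hJne
  · intro f hf
    rw [hsum']
    exact eval_component_eq_zero (by omega) hvan (B ^ n) (fun i => B ^ (i : ℕ)) J hf
  · rw [hsum']; exact hsupp
  · rw [hsum']
    refine weightVector_of_combined hB (weightedHomogeneousComponent_isWeightedHomogeneous J E)
      (fun α hα => ?_) hJne
    have hdegα : α.degree ≤ N ^ a := by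
      rw [Finsupp.degree_apply]
      exact (le_totalDegree (hsupp hα)).trans hdegE
    constructor
    · calc n * α.degree ≤ n * N ^ a := Nat.mul_le_mul_left _ hdegα
        _ < B := Nat.lt_succ_self _
    · calc α.degree ≤ N ^ a := hdegα
        _ ≤ n * N ^ a := Nat.le_mul_of_pos_left _ (by omega)
        _ < B := Nat.lt_succ_self _

/-! ## §2 Top support: from the top frame into the full frame -/

/-- **A top-frame witness renamed along `topIncl` is a full-frame witness supported on the top
coefficients** (same level). [folklore] -/
theorem eq_top_of_topEq {a b : ℕ} {q : ℕ} (hq : q ≤ (Nat.choose (2 * n) n) ^ a)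
    (Ht : MvPolynomial (↥(topMonomials n) ⊕ Fin q) ℂ)
    (hc : complexity Ht ≤ (Nat.choose (2 * n) n) ^ a) (hd : Ht.totalDegree ≤ (Nat.choose (2 * n) n) ^ a)
    (hne : boolSum Ht ≠ 0)
    (hvan : ∀ f ∈ SmallCircuits ℂ n b,
      eval (fun e : topMonomials n => coeff (e : Fin n →₀ ℕ) f) (boolSum Ht) = 0) :
    ∃ H : MvPolynomial (↥(degLEMonomials n) ⊕ Fin q) ℂ, q ≤ (Nat.choose (2 * n) n) ^ a ∧
      complexity H ≤ (Nat.choose (2 * n) n) ^ a ∧ H.totalDegree ≤ (Nat.choose (2 * n) n) ^ a ∧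
      boolSum H ≠ 0 ∧
      (∀ f ∈ SmallCircuits ℂ n b, eval (coeffVector (degLEMonomials n) f) (boolSum H) = 0) ∧
      ∀ α ∈ (boolSum H).support, ∀ m ∈ α.support,
        ((m : degLEMonomials n) : Fin n →₀ ℕ).degree = n := by
  classical
  refine ⟨rename (Sum.map (topIncl n) id) Ht, hq, (complexity_rename_le_holds' _ _).trans hc,
    (totalDegree_rename_le _ _).trans hd, ?_, ?_, ?_⟩
  · rw [boolSum_rename_sumMap]
    exact fun hz => hne (rename_injective _ (topIncl_injective n) (by rw [hz, map_zero]))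
  · intro f hf
    rw [boolSum_rename_sumMap, eval_rename]
    exact hvan f hf
  · intro α hα m hm
    rw [boolSum_rename_sumMap, support_rename_of_injective (topIncl_injective n),
      Finset.mem_image] at hα
    obtain ⟨β, -, rfl⟩ := hα
    obtain ⟨e, -, rfl⟩ := Finset.mem_image.mp (Finsupp.mapDomain_support hm)
    exact e.2

/-- For a TOP-SUPPORTED torus weight vector `E ≠ 0` of weight `(d; w)`: `Σ_i w_i = n · d`
(`Σ_i Σ_m α_m m_i = Σ_m α_m |m| = n Σ_m α_m` for any monomial `α` of `E`). [folklore] -/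
theorem weightSum_eq_of_top {E : MvPolynomial (degLEMonomials n) ℂ} (hE : E ≠ 0)
    (htop : ∀ α ∈ E.support, ∀ m ∈ α.support, ((m : degLEMonomials n) : Fin n →₀ ℕ).degree = n)
    {d : ℕ} {w : Fin n → ℕ} (hhom : E.IsHomogeneous d)
    (hiso : ∀ i : Fin n, IsWeightedHomogeneous
      (fun m : degLEMonomials n => (m : Fin n →₀ ℕ) i) E (w i)) :
    ∑ i, w i = n * d := by
  classical
  obtain ⟨α, hα⟩ := Finset.nonempty_iff_ne_empty.2 (support_eq_empty.not.2 hE)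
  have hcoeff : coeff α E ≠ 0 := mem_support_iff.mp hα
  have hd : d = α.degree := by
    rw [← weight_one_eq_degree]; exact (hhom hcoeff).symm
  have hw : ∀ i, w i = Finsupp.weight (fun m : degLEMonomials n => (m : Fin n →₀ ℕ) i) α :=
    fun i => (hiso i hcoeff).symm
  simp only [hw, hd, Finsupp.weight_apply, Finsupp.sum, smul_eq_mul, Finsupp.degree_apply]
  rw [Finset.sum_comm, Finset.mul_sum]
  refine Finset.sum_congr rfl fun m hm => ?_
  rw [← Finset.mul_sum, mul_comm]
  congr 1
  have h := htop α hα m hm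
  rw [Finsupp.degree_apply] at h
  exact (Finset.sum_subset (Finset.subset_univ _) fun i _ hi =>
    Finsupp.notMem_support_iff.mp hi).symm.trans h

/-! ## §3 The combined normal form -/

/-- **Pointwise: `Eq(n, b+6, a) → WeightVectorEq(n+1, b, a+3)`** (`n ≥ 2^(b+6)`, `n ≥ 63`,
`n ≥ 2a + 5`): dehomogenise to a top witness at `n + 1` (`TopEquations.topEq_succ_of_eq`), move it
to the full frame (`eq_top_of_topEq`), and extract an isobaric component (`isoEq_of_eq_support`).
[folklore] -/
theorem weightVectorEq_succ_of_eq {a b : ℕ} (hn : 2 ^ (b + 6) ≤ n) (h64 : 63 ≤ n) (ha : 2 * a + 5 ≤ n)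
    (h : ∃ q : ℕ, q ≤ (Nat.choose (2 * n) n) ^ a ∧
      ∃ H : MvPolynomial (↥(degLEMonomials n) ⊕ Fin q) ℂ,
        complexity H ≤ (Nat.choose (2 * n) n) ^ a ∧ H.totalDegree ≤ (Nat.choose (2 * n) n) ^ a ∧
        boolSum H ≠ 0 ∧
        ∀ f ∈ SmallCircuits ℂ n (b + 6), eval (coeffVector (degLEMonomials n) f) (boolSum H) = 0) :
    ∃ q : ℕ, q ≤ (Nat.choose (2 * (n + 1)) (n + 1)) ^ (a + 3) ∧
      ∃ H : MvPolynomial (↥(degLEMonomials (n + 1)) ⊕ Fin q) ℂ,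
        complexity H ≤ (Nat.choose (2 * (n + 1)) (n + 1)) ^ (a + 3) ∧
        H.totalDegree ≤ (Nat.choose (2 * (n + 1)) (n + 1)) ^ (a + 3) ∧ boolSum H ≠ 0 ∧
        (∀ f ∈ SmallCircuits ℂ (n + 1) b,
          eval (coeffVector (degLEMonomials (n + 1)) f) (boolSum H) = 0) ∧
        (∀ α ∈ (boolSum H).support, ∀ m ∈ α.support,
          ((m : degLEMonomials (n + 1)) : Fin (n + 1) →₀ ℕ).degree = n + 1) ∧
        ∃ (d : ℕ) (w : Fin (n + 1) → ℕ), (boolSum H).IsHomogeneous d ∧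
          (∀ i : Fin (n + 1), IsWeightedHomogeneous
            (fun m : degLEMonomials (n + 1) => (m : Fin (n + 1) →₀ ℕ) i) (boolSum H) (w i)) ∧
          ∑ i, w i = (n + 1) * d := by
  have hb : 2 ^ (b + 2 + 4) ≤ n := by simpa [Nat.add_right_comm] using hn
  obtain ⟨q, hq, Ht, hc, hd, hne, hvan⟩ :=
    TopEquations.topEq_succ_of_eq (a := a) (b := b + 2) (n := n) hb h
  obtain ⟨H, hq', hc', hd', hne', hvan', htop⟩ := eq_top_of_topEq (b := b + 2) hq Ht hc hd hne hvan
  obtain ⟨q', hq'', H', hc'', hd'', hne'', hvan'', hsupp, d, w, hhom, hiso⟩ :=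
    isoEq_of_eq_support (a := a) (b := b) (by omega) (by omega) hq' H hc' hd' hne' hvan'
  have htop' : ∀ α ∈ (boolSum H').support, ∀ m ∈ α.support,
      ((m : degLEMonomials (n + 1)) : Fin (n + 1) →₀ ℕ).degree = n + 1 :=
    fun α hα m hm => htop α (hsupp hα) m hm
  exact ⟨q', hq'', H', hc'', hd'', hne'', hvan'', htop', d, w, hhom, hiso,
    weightSum_eq_of_top hne'' htop' hhom hiso⟩

/-- **`DefinableEquations` in weight-vector normal form.**  The crux holds iff for ONE level `a` and
EVERY `b`, eventually in `n`, some nonzero level-`a` Boolean-sum equation against `SmallCircuits ℂ n b`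
involves only the top coefficients `c_m`, `|m| = n`, and is a torus weight vector of weight
`(d; w)` with `Σ_i w_i = n·d` — a weight vector of the `GL_n`-module `Sym^d(Sym^n ℂ^n)^*`.
[cite: ForbesShpilkaVolk2018, Def. 1] -/
theorem definableEquations_iff_weightVector :
    Summit.ValiantsHypothesis.ValiantsHypothesis.Theses.BarrierLever.DefinableEquations ↔
      ∃ a : ℕ, ∀ b : ℕ, ∃ n₀ : ℕ, ∀ n ≥ n₀, ∃ q : ℕ, q ≤ (Nat.choose (2 * n) n) ^ a ∧
        ∃ H : MvPolynomial (↥(degLEMonomials n) ⊕ Fin q) ℂ,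
          complexity H ≤ (Nat.choose (2 * n) n) ^ a ∧ H.totalDegree ≤ (Nat.choose (2 * n) n) ^ a ∧
          boolSum H ≠ 0 ∧
          (∀ f ∈ SmallCircuits ℂ n b, eval (coeffVector (degLEMonomials n) f) (boolSum H) = 0) ∧
          (∀ α ∈ (boolSum H).support, ∀ m ∈ α.support,
            ((m : degLEMonomials n) : Fin n →₀ ℕ).degree = n) ∧
          ∃ (d : ℕ) (w : Fin n → ℕ), (boolSum H).IsHomogeneous d ∧
            (∀ i : Fin n, IsWeightedHomogeneous
              (fun m : degLEMonomials n => (m : Fin n →₀ ℕ) i) (boolSum H) (w i)) ∧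
            ∑ i, w i = n * d := by
  constructor
  · rintro ⟨a, h⟩
    refine ⟨a + 3, fun b => ?_⟩
    obtain ⟨n₁, hn₁⟩ := h (b + 6)
    refine ⟨max n₁ (max (2 ^ (b + 6)) (max 63 (2 * a + 5))) + 1, fun n hn => ?_⟩
    have hA := le_max_left n₁ (max (2 ^ (b + 6)) (max 63 (2 * a + 5)))
    have hB := le_max_right n₁ (max (2 ^ (b + 6)) (max 63 (2 * a + 5)))
    have hC := le_max_left (2 ^ (b + 6)) (max 63 (2 * a + 5))
    have hD := le_max_right (2 ^ (b + 6)) (max 63 (2 * a + 5))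
    have hE := le_max_left 63 (2 * a + 5)
    have hF := le_max_right 63 (2 * a + 5)
    obtain ⟨n', rfl⟩ : ∃ n', n = n' + 1 := ⟨n - 1, by omega⟩
    exact weightVectorEq_succ_of_eq (by omega) (by omega) (by omega) (hn₁ n' (by omega))
  · rintro ⟨a, h⟩
    refine ⟨a, fun b => ?_⟩
    obtain ⟨n₀, hn₀⟩ := h b
    refine ⟨n₀, fun n hn => ?_⟩
    obtain ⟨q, hq, H, hc, hd, hne, hvan, -⟩ := hn₀ n hn
    exact ⟨q, hq, H, hc, hd, hne, hvan⟩

/-- **`SingleSizeEquations` in weight-vector normal form** (the `∀ b ∃ a` item,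
stmt-ValiantsHypothesis-8749). [cite: ForbesShpilkaVolk2018, Def. 1] -/
theorem singleSizeEquations_iff_weightVector :
    Summit.ValiantsHypothesis.ValiantsHypothesis.Theses.BarrierLever.SingleSizeEquations ↔
      ∀ b : ℕ, ∃ a n₀ : ℕ, ∀ n ≥ n₀, ∃ q : ℕ, q ≤ (Nat.choose (2 * n) n) ^ a ∧
        ∃ H : MvPolynomial (↥(degLEMonomials n) ⊕ Fin q) ℂ,
          complexity H ≤ (Nat.choose (2 * n) n) ^ a ∧ H.totalDegree ≤ (Nat.choose (2 * n) n) ^ a ∧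
          boolSum H ≠ 0 ∧
          (∀ f ∈ SmallCircuits ℂ n b, eval (coeffVector (degLEMonomials n) f) (boolSum H) = 0) ∧
          (∀ α ∈ (boolSum H).support, ∀ m ∈ α.support,
            ((m : degLEMonomials n) : Fin n →₀ ℕ).degree = n) ∧
          ∃ (d : ℕ) (w : Fin n → ℕ), (boolSum H).IsHomogeneous d ∧
            (∀ i : Fin n, IsWeightedHomogeneous
              (fun m : degLEMonomials n => (m : Fin n →₀ ℕ) i) (boolSum H) (w i)) ∧
            ∑ i, w i = n * d := by
  constructor
  · intro h b
    obtain ⟨a, n₁, hn₁⟩ := h (b + 6)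
    refine ⟨a + 3, max n₁ (max (2 ^ (b + 6)) (max 63 (2 * a + 5))) + 1, fun n hn => ?_⟩
    have hA := le_max_left n₁ (max (2 ^ (b + 6)) (max 63 (2 * a + 5)))
    have hB := le_max_right n₁ (max (2 ^ (b + 6)) (max 63 (2 * a + 5)))
    have hC := le_max_left (2 ^ (b + 6)) (max 63 (2 * a + 5))
    have hD := le_max_right (2 ^ (b + 6)) (max 63 (2 * a + 5))
    have hE := le_max_left 63 (2 * a + 5)
    have hF := le_max_right 63 (2 * a + 5)
    obtain ⟨n', rfl⟩ : ∃ n', n = n' + 1 := ⟨n - 1, by omega⟩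
    exact weightVectorEq_succ_of_eq (by omega) (by omega) (by omega) (hn₁ n' (by omega))
  · intro h b
    obtain ⟨a, n₀, hn₀⟩ := h b
    refine ⟨a, n₀, fun n hn => ?_⟩
    obtain ⟨q, hq, H, hc, hd, hne, hvan, -⟩ := hn₀ n hn
    exact ⟨q, hq, H, hc, hd, hne, hvan⟩

end Summit.ValiantsHypothesis.ValiantsHypothesis.Theorems.BarrierLever.IsobaricEquations

end
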